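import Literature.RepresentationTheory.ClassicalInvariants.WeylGroupF4
import Literature.RepresentationTheory.ClassicalInvariants.WeylGroupF4InvariantsLowDegree
import Literature.RepresentationTheory.ClassicalInvariants.WeylGroupF4Degrees
import HarnessLib

/-!
# The degrees of `W(F₄)` are `2, 6, 8, 12` (Humphreys § 3.7, Table 1, row F₄) — the discharge

## Source (verbatim)

J. E. Humphreys, *Reflection Groups and Coxeter Groups* (Cambridge, 1990) [Humphreys1990], § 3.7 Table 1 «Degrees of
basic invariants […] F₄ | 2, 6, 8, 12» (PDF p. 63); § 3.9 Theorem «`d₁d₂⋯dₙ = |W|`», «`d₁ + d₂ + … + dₙ = N + n`»;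
§ 2.11 «(F₄) There are 24 long roots. […] Therefore `|W| = 24 · 48 = 1152 = 2⁷3²`» (PDF p. 49) and Table 2
«|W| and |Φ| for Weyl groups»: F₄ | `2⁷3²` | `48` (PDF p. 50); § 2.12 (F₄): «in agreement with the calculation
`|W| = 2⁷3²` in 2.11 above».

## Proof implemented (differs from the book's route via § 3.19; recorded here)

By Chevalley's theorem for `𝔉 = W(F₄)` (`WeylGroupF4.weylF4_exists_basicInvariants_degrees`) there are basic
invariants `f₀, …, f₃` of degrees `dᵢ > 0` with `∏ dᵢ = |𝔉| ≤ 1152` (`natCard_weylF4_le`). Every element of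
`ℝ[f] = ℝ[x]^{W(F₄)}` is symmetric, flip-invariant and invariant under `xⱼ ↦ xⱼ − ½Σxᵢ`; by
`WeylGroupF4InvariantsLowDegree`: no `dᵢ` is odd, `p₂ ∈ ℝ[f]` forces some `dᵢ = 2`, and
`dim ℝ[f]_a = #{β : Σ βᵢdᵢ = a}` (the tree's `finrank_inf_rangeAeval_eq_natCard`) is `≤ 1, ≤ 2, ≤ 3` for
`a = 4, 6, 10`. The numerical pin `exists_perm_eq_of_bounds` then gives `{dᵢ} = {2, 6, 8, 12}`; reindexing the
`fᵢ` yields the named fact `WeylGroupF4Degrees.Humphreys1990_weylGroupF4_basicInvariantDegrees`, and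
`|W(F₄)| = 2·6·8·12 = 1152` (`natCard_weylF4`) — Humphreys' § 2.12 count, recovered. § 4 records the result in
the tree's canonical form `ReflectionGroupDegrees.degrees 𝔉 = {2, 6, 8, 12}` (`degrees_weylF4`) and the number of
reflections `N = 24` (`natCard_reflections_weylF4`, § 3.9 «`Σ dᵢ = N + n`», § 2.11 Table 2).

Theorems only; no definitions, no named facts (this file DISCHARGES one).
-/

open MvPolynomial
open scoped BigOperators

namespace Literature.RepresentationTheory.ClassicalInvariants.WeylGroupF4

open Literature.RepresentationTheory.ClassicalInvariants.SymmetricPolynomialsHilbertSeries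
  (exists_isWeightedHomogeneous_aeval_eq finrank_inf_rangeAeval_eq_natCard)
open Literature.RepresentationTheory.ClassicalInvariants.WeylGroupF4Degrees (IsWeylF4Invariant halfSumSubst)
open Literature.RepresentationTheory.ClassicalInvariants.WeylGroupTypeDBasicInvariants (psum_isHomogeneous)

noncomputable section

/-! ### § 1 Elements of `ℝ[x]^{W(F₄)}` -/

/-- Every element of the algebra generated by the homogeneous `W(F₄)`-invariants of positive degree is symmetric,
flip-invariant and invariant under `xⱼ ↦ xⱼ − ½ Σ xᵢ`. [cite: Humphreys1990, §3.1 (R = S^W is a subalgebra)] -/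
theorem invariant_of_mem_adjoin {g : MvPolynomial (Fin 4) ℝ}
    (hg : g ∈ Algebra.adjoin ℝ {g : MvPolynomial (Fin 4) ℝ |
      (g.IsSymmetric ∧
        (∀ i : Fin 4, aeval (fun j => (if j = i then (-1 : ℝ) else 1) • (X j : MvPolynomial (Fin 4) ℝ)) g = g) ∧
          aeval (fun j => X j - C (1 / 2 : ℝ) * ∑ i, (X i : MvPolynomial (Fin 4) ℝ)) g = g) ∧
      ∃ d, 0 < d ∧ g.IsHomogeneous d}) :
    g.IsSymmetric ∧
      (∀ i : Fin 4, aeval (fun j => (if j = i then (-1 : ℝ) else 1) • (X j : MvPolynomial (Fin 4) ℝ)) g = g) ∧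
        aeval (fun j => X j - C (1 / 2 : ℝ) * ∑ i, (X i : MvPolynomial (Fin 4) ℝ)) g = g := by
  refine ⟨?_, fun i => ?_, ?_⟩
  · have hmem : g ∈ symmetricSubalgebra (Fin 4) ℝ := by
      refine Algebra.adjoin_le (fun p hp => ?_) hg
      exact (mem_symmetricSubalgebra p).mpr hp.1.1
    exact (mem_symmetricSubalgebra g).mp hmem
  · have hmem : g ∈ AlgHom.equalizer
        (aeval fun j => (if j = i then (-1 : ℝ) else 1) • (X j : MvPolynomial (Fin 4) ℝ))
        (AlgHom.id ℝ (MvPolynomial (Fin 4) ℝ)) := by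
      refine Algebra.adjoin_le (fun p hp => ?_) hg
      rw [SetLike.mem_coe, AlgHom.mem_equalizer, AlgHom.id_apply]
      exact hp.1.2.1 i
    rwa [AlgHom.mem_equalizer, AlgHom.id_apply] at hmem
  · have hmem : g ∈ AlgHom.equalizer
        (aeval fun j => X j - C (1 / 2 : ℝ) * ∑ i, (X i : MvPolynomial (Fin 4) ℝ))
        (AlgHom.id ℝ (MvPolynomial (Fin 4) ℝ)) := by
      refine Algebra.adjoin_le (fun p hp => ?_) hg
      rw [SetLike.mem_coe, AlgHom.mem_equalizer, AlgHom.id_apply]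
      exact hp.1.2.2
    rwa [AlgHom.mem_equalizer, AlgHom.id_apply] at hmem

/-- `p₂ = Σ xᵢ²` is a homogeneous `W(F₄)`-invariant of degree `2`. [cite: Humphreys1990, §3.7 Table 1 (F₄: d₁ = 2)] -/
theorem psum_two_mem :
    psum (Fin 4) ℝ 2 ∈ {g : MvPolynomial (Fin 4) ℝ |
      (g.IsSymmetric ∧
        (∀ i : Fin 4, aeval (fun j => (if j = i then (-1 : ℝ) else 1) • (X j : MvPolynomial (Fin 4) ℝ)) g = g) ∧
          aeval (fun j => X j - C (1 / 2 : ℝ) * ∑ i, (X i : MvPolynomial (Fin 4) ℝ)) g = g) ∧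
      ∃ d, 0 < d ∧ g.IsHomogeneous d} := by
  refine ⟨⟨psum_isSymmetric (Fin 4) ℝ 2, fun i => ?_, aeval_halfSum_psum_two⟩, 2, two_pos, psum_isHomogeneous 2⟩
  simp only [psum, Fin.sum_univ_four, map_add, map_pow, aeval_X, smul_pow, even_two, Even.neg_pow, one_pow,
    ite_pow]
  simp

/-! ### § 2 The degree bounds for a system of basic invariants of `W(F₄)` -/

section Bounds

variable {f : Fin 4 → MvPolynomial (Fin 4) ℝ} {d : Fin 4 → ℕ}

/-- **No degree of `W(F₄)` is odd** (a basic invariant of odd degree would be a `W(B₄)`-invariant of odd degree,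
hence `0`). [cite: Humphreys1990, §3.7 Table 1 (F₄, B₄: all degrees even)] -/
theorem even_degree (hai : AlgebraicIndependent ℝ f)
    (hfd : ∀ i, (∀ e ∈ weylF4, e (f i) = f i) ∧ 0 < d i ∧ (f i).IsHomogeneous (d i)) (i : Fin 4) :
    Even (d i) := by
  rcases Nat.even_or_odd (d i) with h | h
  · exact h
  · exfalso
    have hinv := (forall_mem_weylF4_apply_eq_iff (f i)).mp (hfd i).1
    exact hai.ne_zero i (eq_zero_of_odd hinv.1 hinv.2.1 (hfd i).2.2 h)

/-- **Some degree of `W(F₄)` is `2`**: `p₂ ∈ ℝ[f]` is homogeneous of degree `2`, so some monomial in the `fᵢ` has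
weight `2`; as all `dᵢ` are even and positive, that monomial is a single `fᵢ` with `dᵢ = 2`.
[cite: Humphreys1990, §3.7 Table 1 (F₄: d₁ = 2)] -/
theorem exists_degree_eq_two (hai : AlgebraicIndependent ℝ f)
    (hfd : ∀ i, (∀ e ∈ weylF4, e (f i) = f i) ∧ 0 < d i ∧ (f i).IsHomogeneous (d i))
    (hgen : Algebra.adjoin ℝ (Set.range f) = Algebra.adjoin ℝ {g : MvPolynomial (Fin 4) ℝ |
      (g.IsSymmetric ∧
        (∀ i : Fin 4, aeval (fun j => (if j = i then (-1 : ℝ) else 1) • (X j : MvPolynomial (Fin 4) ℝ)) g = g) ∧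
          aeval (fun j => X j - C (1 / 2 : ℝ) * ∑ i, (X i : MvPolynomial (Fin 4) ℝ)) g = g) ∧
      ∃ d, 0 < d ∧ g.IsHomogeneous d}) :
    ∃ i, d i = 2 := by
  have hmem : psum (Fin 4) ℝ 2 ∈ (aeval f : MvPolynomial (Fin 4) ℝ →ₐ[ℝ] MvPolynomial (Fin 4) ℝ).range := by
    rw [aeval_range, hgen]
    exact Algebra.subset_adjoin psum_two_mem
  obtain ⟨q, hqw, hq⟩ := exists_isWeightedHomogeneous_aeval_eq (fun i => (hfd i).2.2)
    (psum_isHomogeneous 2) hmem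
  have hq0 : q ≠ 0 := by
    rintro rfl
    rw [map_zero] at hq
    have := congrArg (coeff (Finsupp.single (0 : Fin 4) 2)) hq
    rw [coeff_zero, psum] at this
    simp only [coeff_sum, coeff_X_pow, Finsupp.single_eq_single_iff] at this
    simp at this
  obtain ⟨β, hβ⟩ := MvPolynomial.ne_zero_iff.mp hq0
  have hw : Finsupp.weight d β = 2 := hqw hβ
  by_contra hne
  have hge : ∀ i, 4 ≤ d i := fun i => by
    have h1 := (hfd i).2.1
    have h2 : d i ≠ 2 := fun h => hne ⟨i, h⟩
    obtain ⟨r, hr⟩ := even_degree hai hfd i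
    omega
  by_cases hβ0 : β = 0
  · rw [hβ0, map_zero] at hw
    exact absurd hw (by norm_num)
  · obtain ⟨i, hi⟩ : ∃ i, β i ≠ 0 := by
      by_contra h
      exact hβ0 (Finsupp.ext fun i => not_not.mp fun hi => h ⟨i, hi⟩)
    have := Finsupp.le_weight_of_ne_zero' (w := d) hi
    have := hge i
    omega

/-- The graded pieces of `ℝ[f] = ℝ[x]^{W(F₄)}` in degrees `4`, `6`, `10` have dimension `≤ 1`, `≤ 2`, `≤ 3`, i.e.
**at most `1`, `2`, `3` monomials in the `fᵢ` have weight `4`, `6`, `10`**.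
[cite: Humphreys1990, §3.7 Table 1 (F₄: 2, 6, 8, 12)] -/
theorem natCard_weight_le (hai : AlgebraicIndependent ℝ f)
    (hfd : ∀ i, (∀ e ∈ weylF4, e (f i) = f i) ∧ 0 < d i ∧ (f i).IsHomogeneous (d i))
    (hgen : Algebra.adjoin ℝ (Set.range f) = Algebra.adjoin ℝ {g : MvPolynomial (Fin 4) ℝ |
      (g.IsSymmetric ∧
        (∀ i : Fin 4, aeval (fun j => (if j = i then (-1 : ℝ) else 1) • (X j : MvPolynomial (Fin 4) ℝ)) g = g) ∧
          aeval (fun j => X j - C (1 / 2 : ℝ) * ∑ i, (X i : MvPolynomial (Fin 4) ℝ)) g = g) ∧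
      ∃ d, 0 < d ∧ g.IsHomogeneous d}) :
    Nat.card {β : Fin 4 →₀ ℕ // Finsupp.weight d β = 4} ≤ 1 ∧
      Nat.card {β : Fin 4 →₀ ℕ // Finsupp.weight d β = 6} ≤ 2 ∧
        Nat.card {β : Fin 4 →₀ ℕ // Finsupp.weight d β = 10} ≤ 3 := by
  have hdeg : ∀ i, (f i).IsHomogeneous (d i) := fun i => (hfd i).2.2
  -- an element of `𝒫ᵃ ∩ ℝ[f]` is an invariant homogeneous polynomial of degree `a`
  have key : ∀ (a : ℕ) (g : MvPolynomial (Fin 4) ℝ),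
      g ∈ homogeneousSubmodule (Fin 4) ℝ a ⊓ Subalgebra.toSubmodule (aeval f).range →
        (g.IsSymmetric ∧
          (∀ i : Fin 4, aeval (fun j => (if j = i then (-1 : ℝ) else 1) • (X j : MvPolynomial (Fin 4) ℝ)) g = g) ∧
            aeval (fun j => X j - C (1 / 2 : ℝ) * ∑ i, (X i : MvPolynomial (Fin 4) ℝ)) g = g) ∧
        g.IsHomogeneous a := by
    intro a g hg
    rw [Submodule.mem_inf, mem_homogeneousSubmodule, Subalgebra.mem_toSubmodule, aeval_range, hgen] at hg
    exact ⟨invariant_of_mem_adjoin hg.2, hg.1⟩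
  have bound : ∀ (a : ℕ) {n : ℕ} (v : Fin n → MvPolynomial (Fin 4) ℝ),
      (∀ g : MvPolynomial (Fin 4) ℝ,
        (g.IsSymmetric ∧
          (∀ i : Fin 4, aeval (fun j => (if j = i then (-1 : ℝ) else 1) • (X j : MvPolynomial (Fin 4) ℝ)) g = g) ∧
            aeval (fun j => X j - C (1 / 2 : ℝ) * ∑ i, (X i : MvPolynomial (Fin 4) ℝ)) g = g) →
        g.IsHomogeneous a → g ∈ Submodule.span ℝ (Set.range v)) →
      Nat.card {β : Fin 4 →₀ ℕ // Finsupp.weight d β = a} ≤ n := by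
    intro a n v hv
    rw [← finrank_inf_rangeAeval_eq_natCard hai hdeg a]
    haveI := Module.Finite.span_of_finite ℝ (Set.finite_range v)
    calc Module.finrank ℝ ↥(homogeneousSubmodule (Fin 4) ℝ a ⊓ Subalgebra.toSubmodule (aeval f).range)
        ≤ Module.finrank ℝ ↥(Submodule.span ℝ (Set.range v)) :=
          Submodule.finrank_mono fun g hg => hv g (key a g hg).1 (key a g hg).2
      _ ≤ n := (finrank_range_le_card v).trans_eq (Fintype.card_fin n)
  exact ⟨bound 4 _ fun g hg hga => mem_span_of_invariant_four hg.1 hg.2.1 hg.2.2 hga,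
    bound 6 _ fun g hg hga => mem_span_of_invariant_six hg.1 hg.2.1 hg.2.2 hga,
    bound 10 _ fun g hg hga => mem_span_of_invariant_ten hg.1 hg.2.1 hg.2.2 hga⟩

end Bounds

/-! ### § 3 The degrees of `W(F₄)` and `|W(F₄)| = 1152` -/

/-- **Humphreys § 3.7, Table 1, row F₄ (with Chevalley § 3.5): basic invariants of `W(F₄)` of degrees `2, 6, 8, 12`**,
in the spelling of `WeylGroupF4.weylF4_exists_basicInvariants_degrees` (invariance = symmetric ∧ flips ∧ half-sum
reflection), together with `|𝔉| = 1152`. [cite: Humphreys1990, §3.7 Table 1 (F₄: 2, 6, 8, 12) with §3.5 Theorem and §2.12 (|W| = 1152)] -/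
theorem weylF4_exists_basicInvariants_degrees_eq :
    ∃ f : Fin 4 → MvPolynomial (Fin 4) ℝ, AlgebraicIndependent ℝ f ∧
      (∀ i, (∀ e ∈ weylF4, e (f i) = f i) ∧ (f i).IsHomogeneous ((![2, 6, 8, 12] : Fin 4 → ℕ) i)) ∧
      Algebra.adjoin ℝ (Set.range f) = Algebra.adjoin ℝ {g : MvPolynomial (Fin 4) ℝ |
        (g.IsSymmetric ∧
          (∀ i : Fin 4, aeval (fun j => (if j = i then (-1 : ℝ) else 1) • (X j : MvPolynomial (Fin 4) ℝ)) g = g) ∧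
            aeval (fun j => X j - C (1 / 2 : ℝ) * ∑ i, (X i : MvPolynomial (Fin 4) ℝ)) g = g) ∧
        ∃ d, 0 < d ∧ g.IsHomogeneous d} ∧
      Nat.card ↥weylF4 = 1152 := by
  obtain ⟨f, d, hai, hfd, hgen, hprod⟩ := weylF4_exists_basicInvariants_degrees
  obtain ⟨h4, h6, h10⟩ := natCard_weight_le hai hfd hgen
  obtain ⟨σ, hσ⟩ := exists_perm_eq_of_bounds (fun i => (hfd i).2.1) (even_degree hai hfd)
    (exists_degree_eq_two hai hfd hgen) h4 h6 h10 (hprod.trans_le natCard_weylF4_le)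
  have hprodσ : ∏ i, d i = 1152 := by
    rw [← Equiv.prod_comp σ d, Fin.prod_univ_four, hσ 0, hσ 1, hσ 2, hσ 3]
    rfl
  refine ⟨f ∘ σ, hai.comp σ σ.injective, fun k => ⟨(hfd (σ k)).1, ?_⟩, ?_, hprod ▸ hprodσ⟩
  · rw [Function.comp_apply, ← hσ k]
    exact (hfd (σ k)).2.2
  · rw [σ.surjective.range_comp]
    exact hgen

/-- **`|W(F₄)| = 1152 = 2 · 6 · 8 · 12`** (Humphreys § 2.12, here from `∏ dᵢ = |W|` and the degrees).
[cite: Humphreys1990, §2.12 (F₄) ("|W| = 24 · 48 = 1152") with §3.9 Theorem] -/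
theorem natCard_weylF4 : Nat.card ↥weylF4 = 1152 :=
  weylF4_exists_basicInvariants_degrees_eq.choose_spec.2.2.2

/-! ### § 4 The degrees in the tree's canonical form and the number of reflections -/

/-- **Humphreys § 3.7 Table 1, row F₄: `degrees W(F₄) = {2, 6, 8, 12}`** for the canonical multiset
`ReflectionGroupDegrees.degrees` of the finite reflection group `(𝔉, incl, weylF4Gens)` (well defined by
`map_degrees_eq_degrees`; compare `degrees_hyperoctahedral`, `degrees_G2`). [cite: Humphreys1990, §3.7 Table 1 (F₄: 2, 6, 8, 12)] -/
theorem degrees_weylF4 :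
    haveI := finite_weylF4
    ReflectionGroupDegrees.degrees weylF4.subtype (fun s => isHomogeneous_of_mem_weylF4 s.2)
      closure_preimage_gens_eq_top (fun _ ht => exists_rootForm_of_mem_gens ht) = {2, 6, 8, 12} := by
  classical
  haveI := finite_weylF4
  obtain ⟨f, hai, hfd, hgen, -⟩ := weylF4_exists_basicInvariants_degrees_eq
  rw [← setOf_invariant_eq_setOf_weylF4] at hgen
  have h := ReflectionGroupDegrees.map_degrees_eq_degrees weylF4.subtype
    (fun s => isHomogeneous_of_mem_weylF4 s.2) closure_preimage_gens_eq_top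
    (fun _ ht => exists_rootForm_of_mem_gens ht) hai (d' := (![2, 6, 8, 12] : Fin 4 → ℕ))
    (fun k => (hfd k).2) (fun k => by fin_cases k <;> decide) hgen
  rw [← h]
  decide

/-- **`W(F₄)` has `N = 24` reflections** (`Σ (dᵢ − 1) = 1 + 5 + 7 + 11 = N`; Table 2: `|Φ| = 48`, one reflection per
pair `±α` of roots). [cite: Humphreys1990, §2.11 Table 2 (F₄: |Φ| = 48) with §3.9 Theorem ("d_1 + … + d_n = N + n")] -/
theorem natCard_reflections_weylF4 :
    Nat.card {g : ↥weylF4 // weylF4.subtype g ≠ 1 ∧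
        ∃ β : MvPolynomial (Fin 4) ℝ, β.IsHomogeneous 1 ∧ β ≠ 0 ∧ ∀ p, β ∣ p - weylF4.subtype g p} = 24 := by
  classical
  haveI := finite_weylF4
  rw [← DegreesSumAndProduct.sum_degrees_sub_one_eq_natCard_reflections weylF4.subtype
    (fun s => isHomogeneous_of_mem_weylF4 s.2) weylF4.subtype_injective closure_preimage_gens_eq_top
    (fun _ ht => exists_rootForm_of_mem_gens ht), degrees_weylF4]
  decide

end

end Literature.RepresentationTheory.ClassicalInvariants.WeylGroupF4

namespace Literature.RepresentationTheory.ClassicalInvariants.WeylGroupF4Degrees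

open Literature.RepresentationTheory.ClassicalInvariants.WeylGroupF4

/-- **DISCHARGE of the named fact `Humphreys1990_weylGroupF4_basicInvariantDegrees`** (Humphreys § 3.7 Table 1, row
F₄: the `W(F₄)`-invariants form a polynomial algebra on homogeneous generators of degrees `2, 6, 8, 12`).
[cite: Humphreys1990, §3.7 Table 1 (F₄: 2, 6, 8, 12) with §3.5 Theorem] -/
theorem Humphreys1990_weylGroupF4_basicInvariantDegrees_holds : Humphreys1990_weylGroupF4_basicInvariantDegrees := by
  obtain ⟨f, hai, hfd, hgen, -⟩ := weylF4_exists_basicInvariants_degrees_eq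
  refine ⟨f, hai, fun i => ⟨?_, (hfd i).2⟩, ?_⟩
  · exact (forall_mem_weylF4_apply_eq_iff (f i)).mp (hfd i).1
  · exact hgen

end Literature.RepresentationTheory.ClassicalInvariants.WeylGroupF4Degrees
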